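import Summits.CriticalPhenomena.PercolationContinuityZ3.Theorems.Transplant.FKConnectivityAllQAntipodalUpc
import Literature.Probability.LatticeModels.RandomClusterFKG
import Literature.Probability.Percolation.PercolationEvents
import HarnessLib

/-!
# Connectivity correlation inequalities for `φ_{w,q}` — the ANTIPODAL WEIGHT IS AN FKG WEIGHT FOR `q ≥ 1` (every finite graph)

Support file (`--supports stmt-CriticalPhenomena-4575`), FK sub-lane `prim-bschramm-fk-2` (gen 12) of the post-continuity
programme; builds on p205010 (kernel theorem, internal audit signed; external expert review pending).  No named facts, no
sorries, standard axioms, no new definitions.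

For an edge set `E` and `γ ⊆ E` the antipodal exponent is `apExp E γ = k(γ) + k(E \ γ)` (file `…AntipodalDefs`).  Since the cluster
count `k` is supermodular (Grimmett 2006, (3.12), the tree's `clusterCount_supermodular`) and `γ ↦ E \ γ` exchanges `∩` and `∪`, the
exponent `apExp E` is SUPERMODULAR on the subsets of `E`; hence for `q ≥ 1` the antipodal weight `γ ↦ q^{apExp E γ}` (extended by `0`
off the subsets of `E`) satisfies the FKG lattice condition `w(a) w(b) ≤ w(a ∩ b) w(a ∪ b)` on the finite distributive lattice
`Finset (Sym2 V)`, and Mathlib's `fkg` (Fortuin–Kasteleyn–Ginibre 1971) applies.  Consequences, for EVERY finite edge set `E` (no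
series–parallel hypothesis) and every `q ≥ 1`:
* `FK.ap_fkg_of_one_le` — `(∑ w f)(∑ w g) ≤ (∑ w)(∑ w f g)` for nonnegative monotone `f, g` (sums over `γ ⊆ E`, `w = q^{apExp E γ}`);
* `FK.apUpc_nonneg_of_one_le` — the antipodal up-correlation functional `apUpc q E s t h ≥ 0` for every monotone `h` (the tree's
  `apUpc_nonneg_of_isTTSP` proves this for EVERY `q > 0` but only on two-terminal series–parallel networks; for `q ≥ 1` no hypothesis
  on `E` is needed);
* `FK.apPsi_nonneg_of_one_le` — the antipodal covariance form `apPsi q E f g ≥ 0` for all monotone `f, g`: every SQUARE-FREE coefficient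
  (in the edge odds) of `Z_E² · Cov_{φ_{z,q}}(f, g)` is nonnegative when `q ≥ 1` — a coefficientwise form of positive association,
  reversing the sign of the `q ≤ 1` results of `…AntipodalUpc` / `…AntipodalMinorUpc`.
So for `q ≥ 1` the antipodal positivity phenomena are instances of FKG on every graph; the series–parallel structure is needed only
for `q < 1` (memo `bschramm/FROM-fk-2-g12-*.md`).
[cite: FortuinKasteleynGinibre1971, Thm. (Prop. 1)] [cite: Grimmett2006, Thm. 3.8, eqs. (3.11)–(3.12) (p. 40); §1.4 eq. (1.20) (p. 15)]
-/

noncomputable section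

namespace Summit.CriticalPhenomena.PercolationContinuityZ3.Theorems

namespace FK

open SimpleGraph Literature.Probability.LatticeModels Literature.Probability.Percolation
open scoped Classical

variable {V : Type*}

/-! ### Supermodularity of the antipodal exponent and the lattice condition -/

section Lattice

variable [Fintype V]

/-- **The antipodal exponent `k(γ) + k(E \ γ)` is supermodular on the subsets of `E`**:
`apExp E a + apExp E b ≤ apExp E (a ∩ b) + apExp E (a ∪ b)` for all `a, b` — supermodularity of the cluster count (Grimmett 2006,
(3.12)) applied to `(a, b)` and to `(E \ a, E \ b)`, whose intersection and union are `E \ (a ∪ b)` and `E \ (a ∩ b)`.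
[cite: Grimmett2006, Thm. 3.8, eq. (3.12) (p. 40)] -/
theorem apExp_supermodular (E a b : Finset (Sym2 V)) :
    apExp E a + apExp E b ≤ apExp E (a ∩ b) + apExp E (a ∪ b) := by
  unfold apExp
  have h₁ := clusterCount_supermodular (↑a : BondConfig V) (↑b : BondConfig V) (∅ : Set V)
  have h₂ := clusterCount_supermodular (↑(E \ a) : BondConfig V) (↑(E \ b) : BondConfig V) (∅ : Set V)
  have e₁ : ((↑a : Set (Sym2 V)) ∩ ↑b) = ↑(a ∩ b) := (Finset.coe_inter a b).symm
  have e₂ : ((↑a : Set (Sym2 V)) ∪ ↑b) = ↑(a ∪ b) := (Finset.coe_union a b).symm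
  have e₃ : ((↑(E \ a) : Set (Sym2 V)) ∩ ↑(E \ b)) = ↑(E \ (a ∪ b)) := by
    rw [← Finset.coe_inter]; congr 1; ext x; simp only [Finset.mem_inter, Finset.mem_sdiff, Finset.mem_union]; tauto
  have e₄ : ((↑(E \ a) : Set (Sym2 V)) ∪ ↑(E \ b)) = ↑(E \ (a ∩ b)) := by
    rw [← Finset.coe_union]; congr 1; ext x; simp only [Finset.mem_inter, Finset.mem_sdiff, Finset.mem_union]; tauto
  rw [e₁, e₂] at h₁
  rw [e₃, e₄] at h₂
  omega

/-- **FKG lattice condition for the antipodal weight (`q ≥ 1`)**: with `w(γ) = q^{k(γ)+k(E\γ)}` for `γ ⊆ E` and `w = 0` otherwise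
(a weight on the finite distributive lattice of all edge sets), `w(a) w(b) ≤ w(a ⊓ b) w(a ⊔ b)`.
[cite: Grimmett2006, Thm. 3.8, eq. (3.11) (p. 40)] [cite: FortuinKasteleynGinibre1971, Thm. (Prop. 1)] -/
theorem ap_lattice_condition {q : ℝ} (hq : 1 ≤ q) (E : Finset (Sym2 V)) (a b : Finset (Sym2 V)) :
    (if a ⊆ E then q ^ apExp E a else 0) * (if b ⊆ E then q ^ apExp E b else 0) ≤
      (if a ⊓ b ⊆ E then q ^ apExp E (a ⊓ b) else 0) * (if a ⊔ b ⊆ E then q ^ apExp E (a ⊔ b) else 0) := by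
  have hq0 : 0 ≤ q := zero_le_one.trans hq
  by_cases ha : a ⊆ E
  swap
  · rw [if_neg ha, zero_mul]
    exact mul_nonneg (by split_ifs <;> positivity) (by split_ifs <;> positivity)
  by_cases hb : b ⊆ E
  swap
  · rw [if_neg hb, mul_zero]
    exact mul_nonneg (by split_ifs <;> positivity) (by split_ifs <;> positivity)
  have hab : a ⊓ b ⊆ E := fun x hx => ha (Finset.mem_inter.1 hx).1
  have hab' : a ⊔ b ⊆ E := Finset.union_subset ha hb
  rw [if_pos ha, if_pos hb, if_pos hab, if_pos hab', ← pow_add, ← pow_add]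
  exact pow_le_pow_right₀ hq (apExp_supermodular E a b)

/-- Sums of the zero-extended antipodal weight over all edge sets are sums over `γ ⊆ E`. [folklore] -/
theorem sum_ite_subset_eq_sum_powerset (E : Finset (Sym2 V)) (φ : Finset (Sym2 V) → ℝ) :
    ∑ γ : Finset (Sym2 V), (if γ ⊆ E then φ γ else 0) = ∑ γ ∈ E.powerset, φ γ := by
  rw [← Finset.sum_filter]
  refine Finset.sum_congr ?_ fun _ _ => rfl
  ext γ
  simp only [Finset.mem_filter, Finset.mem_univ, true_and, Finset.mem_powerset]

/-- **FKG inequality for the antipodal weight, `q ≥ 1`, on every finite edge set**: for nonnegative monotone `f, g` on the edge sets,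
`(∑_{γ⊆E} w f)(∑_{γ⊆E} w g) ≤ (∑_{γ⊆E} w)(∑_{γ⊆E} w f g)` with `w = q^{k(γ)+k(E\γ)}`.
[cite: FortuinKasteleynGinibre1971, Thm. (Prop. 1)] [cite: Grimmett2006, Thm. 3.8 (p. 40)] -/
theorem ap_fkg_of_one_le {q : ℝ} (hq : 1 ≤ q) (E : Finset (Sym2 V)) {f g : Finset (Sym2 V) → ℝ}
    (hf0 : ∀ γ, 0 ≤ f γ) (hg0 : ∀ γ, 0 ≤ g γ) (hf : Monotone f) (hg : Monotone g) :
    (∑ γ ∈ E.powerset, q ^ apExp E γ * f γ) * (∑ γ ∈ E.powerset, q ^ apExp E γ * g γ) ≤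
      (∑ γ ∈ E.powerset, q ^ apExp E γ) * (∑ γ ∈ E.powerset, q ^ apExp E γ * (f γ * g γ)) := by
  have hq0 : 0 ≤ q := zero_le_one.trans hq
  set μ : Finset (Sym2 V) → ℝ := fun γ => if γ ⊆ E then q ^ apExp E γ else 0 with hμ
  have hμ0 : 0 ≤ μ := fun γ => by simp only [hμ, Pi.zero_apply]; split_ifs <;> positivity
  have hlat : ∀ a b, μ a * μ b ≤ μ (a ⊓ b) * μ (a ⊔ b) := fun a b => by
    simp only [hμ]; exact ap_lattice_condition hq E a b
  have key := fkg (μ := μ) (f := f) (g := g) hμ0 (fun γ => hf0 γ) (fun γ => hg0 γ) hf hg hlat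
  have r : ∀ φ : Finset (Sym2 V) → ℝ, ∑ γ, μ γ * φ γ = ∑ γ ∈ E.powerset, q ^ apExp E γ * φ γ := by
    intro φ
    rw [← sum_ite_subset_eq_sum_powerset E (fun γ => q ^ apExp E γ * φ γ)]
    refine Finset.sum_congr rfl fun γ _ => ?_
    simp only [hμ]; split_ifs <;> simp
  have r0 : ∑ γ, μ γ = ∑ γ ∈ E.powerset, q ^ apExp E γ := by
    simpa using r (fun _ => 1)
  rw [r f, r g, r0, r (fun γ => f γ * g γ)] at key
  exact key

end Lattice

/-! ### Consequences: antipodal up-correlation and covariance form are nonnegative for `q ≥ 1` on every graph -/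

section Consequences

variable [Fintype V]

omit [Fintype V] in
/-- The total antipodal mass of `E` is positive (`q > 0`). [folklore] -/
theorem sum_apWeight_pos {q : ℝ} (hq : 0 < q) (E : Finset (Sym2 V)) : 0 < ∑ γ ∈ E.powerset, q ^ apExp E γ :=
  Finset.sum_pos (fun _ _ => pow_pos hq _) ⟨∅, Finset.mem_powerset.2 (Finset.empty_subset E)⟩

omit [Fintype V] in
/-- The signed sum `∑_{γ⊆E} q^{k+k̄} (c(γ) - c(γᶜ)) = 0` (the summand is odd under `γ ↦ E \ γ`). [folklore] -/
theorem sum_apSign_eq_zero (q : ℝ) (E : Finset (Sym2 V)) (s t : V) :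
    ∑ γ ∈ E.powerset, q ^ apExp E γ * (apConn γ s t - apConn (E \ γ) s t) = 0 := by
  have h := sum_apSign_compl q E s t (fun _ => (1 : ℝ))
  have e : apUpc q E s t (fun _ => (1 : ℝ)) = ∑ γ ∈ E.powerset, q ^ apExp E γ * (apConn γ s t - apConn (E \ γ) s t) := by
    unfold apUpc; refine Finset.sum_congr rfl fun γ _ => by ring
  simp only [mul_one] at h
  rw [e] at h
  linarith

/-- The connection indicator is monotone in the configuration. [cite: Grimmett2006, §2.1 (increasing events)] -/
theorem apConn_mono {γ δ : Finset (Sym2 V)} (h : γ ⊆ δ) (s t : V) : apConn γ s t ≤ apConn δ s t := by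
  by_cases hr : (openGraph (↑γ : BondConfig V)).Reachable s t
  · have hr' : (openGraph (↑δ : BondConfig V)).Reachable s t :=
      hr.mono (openGraph_mono (Finset.coe_subset.2 h))
    rw [apConn_of_reachable hr, apConn_of_reachable hr']
  · rw [apConn_of_not_reachable hr]; exact apConn_nonneg δ s t

/-- **Antipodal up-correlation is nonnegative for `q ≥ 1` on EVERY finite two-terminal network** (no series–parallel hypothesis):
`0 ≤ apUpc q E s t h = ∑_{γ⊆E} q^{k(γ)+k(E\γ)} (1{s↔t in γ} - 1{s↔t in E\γ}) h(γ)` for every `h` monotone on the subsets of `E`.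
FKG for the antipodal weight applied to the increasing functions `γ ↦ c(γ ∩ E) - c(E \ γ) + 1` and `γ ↦ h(γ ∩ E) - h(∅)`, the first of
which has antipodal mean `1`.  (For `0 < q < 1` this fails on `K₄`; on series–parallel networks it holds for every `q > 0`,
`apUpc_nonneg_of_isTTSP`.) [cite: FortuinKasteleynGinibre1971, Thm. (Prop. 1)] [cite: Grimmett2006, Thm. 3.8 (p. 40); §3.8 (pp. 61–62)] -/
theorem apUpc_nonneg_of_one_le {q : ℝ} (hq : 1 ≤ q) (E : Finset (Sym2 V)) (s t : V) {h : Finset (Sym2 V) → ℝ}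
    (hmono : ∀ ⦃A B : Finset (Sym2 V)⦄, A ⊆ B → B ⊆ E → h A ≤ h B) : 0 ≤ apUpc q E s t h := by
  have hq0 : 0 < q := zero_lt_one.trans_le hq
  set f : Finset (Sym2 V) → ℝ := fun γ => apConn (γ ∩ E) s t - apConn (E \ γ) s t + 1 with hf
  set g : Finset (Sym2 V) → ℝ := fun γ => h (γ ∩ E) - h ∅ with hg
  have hf0 : ∀ γ, 0 ≤ f γ := fun γ => by
    simp only [hf]; linarith [apConn_nonneg (γ ∩ E) s t, apConn_le_one (E \ γ) s t]
  have hg0 : ∀ γ, 0 ≤ g γ := fun γ => by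
    simp only [hg]; linarith [hmono (Finset.empty_subset (γ ∩ E)) Finset.inter_subset_right]
  have hfm : Monotone f := fun γ δ hγδ => by
    simp only [hf]
    have h1 := apConn_mono (Finset.inter_subset_inter_right hγδ : γ ∩ E ⊆ δ ∩ E) s t
    have h2 := apConn_mono (Finset.sdiff_subset_sdiff (subset_refl E) hγδ : E \ δ ⊆ E \ γ) s t
    linarith
  have hgm : Monotone g := fun γ δ hγδ => by
    simp only [hg]
    linarith [hmono (Finset.inter_subset_inter_right hγδ : γ ∩ E ⊆ δ ∩ E) Finset.inter_subset_right]
  have key := ap_fkg_of_one_le hq E hf0 hg0 hfm hgm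
  -- evaluate the four sums on `γ ⊆ E`
  set Z := ∑ γ ∈ E.powerset, q ^ apExp E γ with hZ
  have hZpos : 0 < Z := sum_apWeight_pos hq0 E
  have ef : ∀ γ ∈ E.powerset, f γ = (apConn γ s t - apConn (E \ γ) s t) + 1 := fun γ hγ => by
    simp only [hf, Finset.inter_eq_left.2 (Finset.mem_powerset.1 hγ)]
  have eg : ∀ γ ∈ E.powerset, g γ = h γ - h ∅ := fun γ hγ => by
    simp only [hg, Finset.inter_eq_left.2 (Finset.mem_powerset.1 hγ)]
  have Sf : ∑ γ ∈ E.powerset, q ^ apExp E γ * f γ = Z := by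
    calc ∑ γ ∈ E.powerset, q ^ apExp E γ * f γ
        = ∑ γ ∈ E.powerset, (q ^ apExp E γ * (apConn γ s t - apConn (E \ γ) s t) + q ^ apExp E γ) :=
          Finset.sum_congr rfl fun γ hγ => by rw [ef γ hγ]; ring
      _ = Z := by rw [Finset.sum_add_distrib, sum_apSign_eq_zero, zero_add]
  have Sg : ∑ γ ∈ E.powerset, q ^ apExp E γ * g γ = (∑ γ ∈ E.powerset, q ^ apExp E γ * h γ) - h ∅ * Z := by
    calc ∑ γ ∈ E.powerset, q ^ apExp E γ * g γ
        = ∑ γ ∈ E.powerset, (q ^ apExp E γ * h γ - h ∅ * q ^ apExp E γ) :=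
          Finset.sum_congr rfl fun γ hγ => by rw [eg γ hγ]; ring
      _ = _ := by rw [Finset.sum_sub_distrib, ← Finset.mul_sum]
  have Sfg : ∑ γ ∈ E.powerset, q ^ apExp E γ * (f γ * g γ) =
      apUpc q E s t h + (∑ γ ∈ E.powerset, q ^ apExp E γ * h γ) - h ∅ * Z := by
    have e1 : ∑ γ ∈ E.powerset, q ^ apExp E γ * (f γ * g γ) =
        ∑ γ ∈ E.powerset, (q ^ apExp E γ * ((apConn γ s t - apConn (E \ γ) s t) * h γ)
          - h ∅ * (q ^ apExp E γ * (apConn γ s t - apConn (E \ γ) s t))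
          + (q ^ apExp E γ * h γ - h ∅ * q ^ apExp E γ)) :=
      Finset.sum_congr rfl fun γ hγ => by rw [ef γ hγ, eg γ hγ]; ring
    rw [e1, Finset.sum_add_distrib, Finset.sum_sub_distrib, Finset.sum_sub_distrib, ← Finset.mul_sum, ← Finset.mul_sum,
      sum_apSign_eq_zero, mul_zero, sub_zero, ← hZ]
    unfold apUpc; ring
  rw [Sf, Sg, Sfg] at key
  -- `Z (S_h - h∅ Z) ≤ Z (apUpc + S_h - h∅ Z)` gives `0 ≤ Z · apUpc`
  have : 0 ≤ Z * apUpc q E s t h := by nlinarith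
  exact (mul_nonneg_iff_of_pos_left hZpos).1 this

/-- **Every square-free coefficient of `Z² Cov_{φ_{z,q}}(f, g)` is nonnegative for `q ≥ 1`, on every finite graph**:
`0 ≤ apPsi q E f g = ∑_{γ⊆E} q^{k(γ)+k(E\γ)} (f(γ) - f(E\γ)) (g(γ) - g(E\γ))` for all `f, g` monotone on the subsets of `E`.
FKG for the antipodal weight applied to the increasing functions `F(γ) = f(γ∩E) - f(E\γ)` and `G` (shifted to be nonnegative), both
of antipodal mean zero by the symmetry `γ ↦ E \ γ`.  (Reverses for `0 < q ≤ 1` on series–parallel graphs: `apPsi_edge_nonpos_of_isTTSP`,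
`apPsiC_edge_nonpos_of_isTTSP`.) [cite: FortuinKasteleynGinibre1971, Thm. (Prop. 1)] [cite: Grimmett2006, Thm. 3.8 (p. 40); §1.4 eq. (1.20)] -/
theorem apPsi_nonneg_of_one_le {q : ℝ} (hq : 1 ≤ q) (E : Finset (Sym2 V)) {f g : Finset (Sym2 V) → ℝ}
    (hf : ∀ ⦃A B : Finset (Sym2 V)⦄, A ⊆ B → B ⊆ E → f A ≤ f B)
    (hg : ∀ ⦃A B : Finset (Sym2 V)⦄, A ⊆ B → B ⊆ E → g A ≤ g B) : 0 ≤ apPsi q E f g := by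
  have hq0 : 0 < q := zero_lt_one.trans_le hq
  set F : Finset (Sym2 V) → ℝ := fun γ => f (γ ∩ E) - f (E \ γ) + (f E - f ∅) with hF
  set G : Finset (Sym2 V) → ℝ := fun γ => g (γ ∩ E) - g (E \ γ) + (g E - g ∅) with hG
  have hF0 : ∀ γ, 0 ≤ F γ := fun γ => by
    simp only [hF]
    linarith [hf (Finset.empty_subset (γ ∩ E)) Finset.inter_subset_right, hf (Finset.sdiff_subset : E \ γ ⊆ E) subset_rfl]
  have hG0 : ∀ γ, 0 ≤ G γ := fun γ => by
    simp only [hG]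
    linarith [hg (Finset.empty_subset (γ ∩ E)) Finset.inter_subset_right, hg (Finset.sdiff_subset : E \ γ ⊆ E) subset_rfl]
  have hFm : Monotone F := fun γ δ hγδ => by
    simp only [hF]
    linarith [hf (Finset.inter_subset_inter_right hγδ : γ ∩ E ⊆ δ ∩ E) Finset.inter_subset_right,
      hf (Finset.sdiff_subset_sdiff (subset_refl E) hγδ : E \ δ ⊆ E \ γ) Finset.sdiff_subset]
  have hGm : Monotone G := fun γ δ hγδ => by
    simp only [hG]
    linarith [hg (Finset.inter_subset_inter_right hγδ : γ ∩ E ⊆ δ ∩ E) Finset.inter_subset_right,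
      hg (Finset.sdiff_subset_sdiff (subset_refl E) hγδ : E \ δ ⊆ E \ γ) Finset.sdiff_subset]
  have key := ap_fkg_of_one_le hq E hF0 hG0 hFm hGm
  set Z := ∑ γ ∈ E.powerset, q ^ apExp E γ with hZ
  have hZpos : 0 < Z := sum_apWeight_pos hq0 E
  set cf := f E - f ∅
  set cg := g E - g ∅
  have eF : ∀ γ ∈ E.powerset, F γ = (f γ - f (E \ γ)) + cf := fun γ hγ => by
    simp only [hF, Finset.inter_eq_left.2 (Finset.mem_powerset.1 hγ), cf]
  have eG : ∀ γ ∈ E.powerset, G γ = (g γ - g (E \ γ)) + cg := fun γ hγ => by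
    simp only [hG, Finset.inter_eq_left.2 (Finset.mem_powerset.1 hγ), cg]
  -- odd parts have zero antipodal mean
  have oddf : ∑ γ ∈ E.powerset, q ^ apExp E γ * (f γ - f (E \ γ)) = 0 := by
    have h1 := sum_powerset_flip E (fun γ => q ^ apExp E γ * (f γ - f (E \ γ)))
    have h2 : ∑ γ ∈ E.powerset, q ^ apExp E (E \ γ) * (f (E \ γ) - f (E \ (E \ γ))) =
        - ∑ γ ∈ E.powerset, q ^ apExp E γ * (f γ - f (E \ γ)) := by
      rw [← Finset.sum_neg_distrib]
      refine Finset.sum_congr rfl fun γ hγ => ?_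
      have hγE := Finset.mem_powerset.1 hγ
      rw [Finset.sdiff_sdiff_eq_self hγE, apExp_compl hγE]; ring
    linarith [h1.trans h2]
  have oddg : ∑ γ ∈ E.powerset, q ^ apExp E γ * (g γ - g (E \ γ)) = 0 := by
    have h1 := sum_powerset_flip E (fun γ => q ^ apExp E γ * (g γ - g (E \ γ)))
    have h2 : ∑ γ ∈ E.powerset, q ^ apExp E (E \ γ) * (g (E \ γ) - g (E \ (E \ γ))) =
        - ∑ γ ∈ E.powerset, q ^ apExp E γ * (g γ - g (E \ γ)) := by
      rw [← Finset.sum_neg_distrib]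
      refine Finset.sum_congr rfl fun γ hγ => ?_
      have hγE := Finset.mem_powerset.1 hγ
      rw [Finset.sdiff_sdiff_eq_self hγE, apExp_compl hγE]; ring
    linarith [h1.trans h2]
  have SF : ∑ γ ∈ E.powerset, q ^ apExp E γ * F γ = cf * Z := by
    calc ∑ γ ∈ E.powerset, q ^ apExp E γ * F γ
        = ∑ γ ∈ E.powerset, (q ^ apExp E γ * (f γ - f (E \ γ)) + cf * q ^ apExp E γ) :=
          Finset.sum_congr rfl fun γ hγ => by rw [eF γ hγ]; ring
      _ = cf * Z := by rw [Finset.sum_add_distrib, oddf, zero_add, ← Finset.mul_sum]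
  have SG : ∑ γ ∈ E.powerset, q ^ apExp E γ * G γ = cg * Z := by
    calc ∑ γ ∈ E.powerset, q ^ apExp E γ * G γ
        = ∑ γ ∈ E.powerset, (q ^ apExp E γ * (g γ - g (E \ γ)) + cg * q ^ apExp E γ) :=
          Finset.sum_congr rfl fun γ hγ => by rw [eG γ hγ]; ring
      _ = cg * Z := by rw [Finset.sum_add_distrib, oddg, zero_add, ← Finset.mul_sum]
  have SFG : ∑ γ ∈ E.powerset, q ^ apExp E γ * (F γ * G γ) = apPsi q E f g + cf * cg * Z := by
    have e1 : ∑ γ ∈ E.powerset, q ^ apExp E γ * (F γ * G γ) =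
        ∑ γ ∈ E.powerset, (q ^ apExp E γ * ((f γ - f (E \ γ)) * (g γ - g (E \ γ)))
          + cg * (q ^ apExp E γ * (f γ - f (E \ γ))) + cf * (q ^ apExp E γ * (g γ - g (E \ γ)))
          + cf * cg * q ^ apExp E γ) :=
      Finset.sum_congr rfl fun γ hγ => by rw [eF γ hγ, eG γ hγ]; ring
    rw [e1, Finset.sum_add_distrib, Finset.sum_add_distrib, Finset.sum_add_distrib, ← Finset.mul_sum, ← Finset.mul_sum,
      ← Finset.mul_sum, oddf, oddg, mul_zero, mul_zero, add_zero, add_zero, ← hZ]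
    unfold apPsi; ring
  rw [SF, SG, SFG] at key
  have : 0 ≤ Z * apPsi q E f g := by nlinarith
  exact (mul_nonneg_iff_of_pos_left hZpos).1 this

end Consequences

end FK

end Summit.CriticalPhenomena.PercolationContinuityZ3.Theorems

end
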